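import Summits.QuantumFields.BalabanUV.T4Continuum.Support.ShellMeasureWilsonRealizedSUN
import Summits.QuantumFields.BalabanUV.T4Continuum.Support.ShellMeasureAxialReachSUN
import Summits.QuantumFields.BalabanUV.T4Continuum.Support.ShellMeasureRootCompositionSUN
import Summits.QuantumFields.BalabanUV.T4Continuum.Support.ShellMeasureLevelZeroWords
import Summits.QuantumFields.BalabanUV.T4Continuum.Support.ShellMeasureWilsonGaugeInvariant

/-!
# `T4Continuum.ShellMeasureWilsonGaugeInvariantSUN` — (M1)₀ REALIZED for `G = SU(N)`, EVERY `N`, with the GAUGE-INVARIANT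
# density and NO BOND WINDOW: the Wilson weight of the block times the indicator «all box plaquettes `σ`-small»; the
# window of row S34 is DERIVED (tree gauge on the axial comb + the `SU(N)` reach of `ShellMeasureAxialReachSUN`), and
# the level data of END-II for `SU(N)` are INHABITED on the cell's own level-0 objects
# (cell `pub-balaban`, sub-cell `t4`, spine estimate NE7c (node U5b); ROUND-2 crew `t4-ne7c-formalise-*`, seat
# `b2b-balaban-t4-ne7c-formalise-leaf-10` (gen 7); c5 orbit of rows S3∕S30∕S31∕S34∕S43 of `t4/b2b-balaban-t4-ne7c-p1/LEAVES-NE7c-P1.md`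
# — `SU(2)` is the certified instance; the `SU(N)` counterpart of S1 `ShellMeasureWilsonGaugeInvariant` (p207446) in
# the END-II form of S11 `ShellMeasureRootCompositionLevelZero` §2 (p208890); ADDITIVE — imports S34, S43, S31 (END-II for
# `SU(N)`), S11 f1 and S1 (generic level-0 word∕geometry lemmas) BY NAME; 0 sorry, 0 citations, no `def … : Prop`)

HONEST FRAMING.  Finite four-torus programme, rung (B)+1 only — NOT infinite volume, NOT a mass gap, NOT the Clay
problem, NOT summit progress; (B), `BetaPertHyp`, (B^μ) not consumed.  (M1) for BAŁABAN'S INDUCTIVELY DEFINED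
EFFECTIVE MEASURES is NOT PRINTED (GAPS G-ne7cp1-1) and NOT moved.  Row S34 realized (M1)₀ for `SU(N)` with the bond
window INSIDE the weight («(LR)₀ assumed»); here the density is GAUGE INVARIANT — the Wilson weight of B12 (0.2) over
`P_w` times the indicator «every box plaquette `σ`-small» (B14 (2.17)'s `χ` at level 0), NO bond window — and the
window is DERIVED: in the tree gauge on the axial comb (inside END-II, `slotAntiConcentration_gaugeFixed_iff`) a
configuration with `σ`-small box plaquettes has every box bond in `expWindowSU 1 S` once `√N·(π/2)·((d−1)·m·σ) ≤ S`,
`N·((d−1)·m·σ) < 4` (`ShellMeasureAxialReachSUN.windowSU_fixTo_comb_eq_one`, row S43).  Still assumed at level 0: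
(MR)₀ in the sense of row S2 (straddling co-tests are not in this density; Λ-blind ones ride free by S34's `_exterior`).
Trigger c3: (M1)₀ realized ≠ NE7c; NOTHING in the countdown moves; `SU(2)` stays the certified instance (c5).  HONEST
DEPENDENCY (cell): continuum YM on T⁴ ⇐ BetaPertH ∧ nine spine estimates (0/9 proved); BetaPertH ⇐ (D1) ∧ (D4) ∧
CAP+tail; G-an2-4 gates asym, D1 and NE2/3/4.

THE THEOREM (`slotAntiConcentration_wilson_suN_gaugeInvariant`).  Non-wrapping box `[lo, hi]` (`hi − lo < sitesPerDir`,
`hi ≤ lo + m`); chart bonds `Λ` = box bonds off the axial comb; window radius `0 ≤ S ≤ 1/4`; co-test threshold `σ > 0`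
with the REACH CONDITIONS `N·((d−1)·m·σ) < 4`, `√N·(π/2)·((d−1)·m·σ) ≤ S`; classifier plaquettes `∅ ≠ P_u ⊆ boxPlaqs`;
weight plaquettes `P_w`; `β ≥ 0`, `θ > 0`, `0 ≤ δ < 1`, `0 ≤ ρ ≤ (1−δ)/2`; a free radius `Rad > 1` with (SM) in
END-II's currency `36(e^{4S·Rad} − 1)/(Rad − 1)² ≤ δθ`, and (SM)_σ `4(4S)²e^{8S} ≤ δσ`.  CONCLUSION:
`SlotAntiConcentration ((fieldMeasure P j SU(N)).withDensity giF) wilsonU θ ρ (2(#Λ·d_N + β·#P_w·4S(8 + 16S))/(1−δ))`,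
by INHABITING the level data of END-II for `SU(N)` (`ShellMeasureRootCompositionSUN.slotAC_realized_suN_of_levelData_ball`,
row S31) on the cell's level-0 objects exactly as S11 §2 does for `SU(2)`: `hol V p x = wordEval 1 (plaqWord Λ V[comb := 1] x p)`
(continuous, §2), (AN-bound)₀ from the LINEAR bond rays (`classifierWitness_linear`, `H = e^{4S·Rad} − 1`), graded
words (`exists_graded_of_word`, `s̄ = L̄ = 4S`, `d̄ = 8`), `𝓔 ≡ 0`, window = the chart ball, kept co-test
`Jco = 1_{ball}·1_{boxTest}` (centre-monotone by the level-0 core map at threshold `σ`), dictionaries = identities.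

WHAT THIS DOES NOT DO.  (MR)₀ (straddling co-tests), anything at `j ≥ 1`; NE7c NOT proved; 0/9 spine.
-/

noncomputable section

open NormedSpace Set Function MeasureTheory Metric

namespace Summit.QuantumFields.BalabanUV.T4Continuum.ShellMeasureWilsonGaugeInvariantSUN

open scoped ENNReal Matrix.Norms.L2Operator
open Literature.MathematicalPhysics.QuantumFieldTheory.Balaban1983to89
open T4ShellMeasure (SlotAntiConcentration)
open T4ShellMeasureDet (blockLaw)
open T4TreeGaugeFixing (NoClosedLoop fixTo noClosedLoop_combBonds measurable_fixTo)
open T4AxialGaugeFixing (combBonds)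
open T4AxialGaugeSmallField (boxPlaqs boxBonds)
open GaugeField (GaugeInvariant)
open ShellMeasureExpChartSUN
open ShellMeasureScalingSUN (windowSU)
open ShellMeasureWilsonWords (scale normSum wordExp coreMap_word interpConst_mono normSum_nonneg scale_one)
open ShellMeasureWilsonTrace (Letter wordEval sGen dFro TraceData)
open ShellMeasureWilsonMoving (mwordEval)
open ShellMeasureWilsonBlock (matrixTrace matrixTrace_N_pos wilson_dictionary_specialUnitaryGroup)
open ShellMeasureLevelAssembly (classifier weight)
open ShellMeasureLevelZeroWords (exists_graded_of_word classifierWitness_linear)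
open ShellMeasureWilsonGaugeInvariant (exists_gens_of_frozen_eq_one bonds_mem_boxBonds
  withDensity_univ_ne_top_of_le_one)
open ShellMeasureHeadlines (fixTo_updateFinset_of_disjoint)
open ShellMeasureWilsonRealizedSUN (MatN gen letter plaqWord coe_plaqHol_eq_wordEval wordEval_plaqWord_smul
  plaqWord_data wilsonU measurable_wilsonU measurable_wilsonSum wilsonSum_nonneg wilsonSum_chart_smul)
open ShellMeasureAxialReachSUN (windowSU_fixTo_comb_eq_one)
open ShellMeasureRootCompositionSUN (slotAC_realized_suN_of_levelData_ball)

variable {N : ℕ} [NeZero N] {P : Params} {j : ℕ}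

/-! ## §1 Comb bonds are unit frozen letters (`SU(N)` twins of S1 §2) -/

section Geometry

variable [DecidableEq (PBond P j)] (Λ : Finset (PBond P j))

omit [NeZero N] in
/-- an exterior bond carrying the value `1` is the frozen UNIT letter, in both orientations. [folklore] -/
theorem letter_frozen_eq_one {W : GaugeField P j (SUN N)} {x : BlockChartSU N Λ} {b : PBond P j} {inv : Bool}
    {a : MatN N} (h : letter Λ W x b inv = Letter.frozen a) (hW : b ∉ Λ → W b = 1) : a = 1 := by
  unfold letter at h
  by_cases hb : b ∈ Λ
  · rw [dif_pos hb] at h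
    exact absurd h (by simp)
  · rw [dif_neg hb, hW hb] at h
    cases inv <;> simp at h <;> exact h.symm

omit [NeZero N] in
/-- **COMB BONDS ARE UNIT FROZEN LETTERS**: every frozen letter of `plaqWord Λ W x p` equals `1` if the box bonds off
`Λ` carry `1` in `W`. [folklore] -/
theorem frozen_eq_one_of_mem_plaqWord {lo hi : Fin P.d → ℤ} {W : GaugeField P j (SUN N)}
    (hW : ∀ b ∈ boxBonds lo hi, b ∉ Λ → W b = 1) (x : BlockChartSU N Λ) {p : Plaq P j} (hp : p ∈ boxPlaqs lo hi) :
    ∀ a, Letter.frozen a ∈ plaqWord Λ W x p → a = 1 := by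
  obtain ⟨h1, h2, h3, h4⟩ := bonds_mem_boxBonds hp
  intro a ha
  unfold plaqWord at ha
  simp only [List.mem_cons, List.not_mem_nil, or_false] at ha
  rcases ha with h | h | h | h
  · exact letter_frozen_eq_one Λ h.symm (hW _ h1)
  · exact letter_frozen_eq_one Λ h.symm (hW _ h2)
  · exact letter_frozen_eq_one Λ h.symm (hW _ h3)
  · exact letter_frozen_eq_one Λ h.symm (hW _ h4)

end Geometry
/-! ## §2 Continuity of the sectioned plaquette words in the chart point (END-II's `hcont` at level 0) -/

section Continuity

variable [DecidableEq (PBond P j)] (Λ : Finset (PBond P j))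

omit [NeZero N] [DecidableEq (PBond P j)] in
/-- the chart generator of a block bond is continuous in the chart point. [folklore] -/
theorem continuous_gen (b : ↥Λ) : Continuous fun x : BlockChartSU N Λ => gen Λ b x :=
  continuous_genSU.comp (continuous_apply b)

omit [NeZero N] [DecidableEq (PBond P j)] in
/-- the matrix exponential on `M_N(ℂ)` is continuous (entire). [folklore] -/
theorem continuous_exp_MatN : Continuous (exp : MatN N → MatN N) :=
  continuous_iff_continuousAt.2 fun x => (NormedSpace.exp_analytic (𝕂 := ℂ) x).continuousAt

omit [NeZero N] in
/-- every letter of a sectioned word, evaluated at a fixed contraction, is continuous in the chart point. [folklore] -/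
theorem continuous_letter_eval (V : GaugeField P j (SUN N)) (b : PBond P j) (inv : Bool) (c : ℝ) :
    Continuous fun x : BlockChartSU N Λ => (letter Λ V x b inv).eval c := by
  unfold letter
  by_cases hb : b ∈ Λ
  · simp only [dif_pos hb]
    cases inv
    · simp only [Bool.false_eq_true, ↓reduceIte, Letter.eval_gen]
      exact continuous_exp_MatN.comp ((continuous_gen Λ ⟨b, hb⟩).const_smul (c : ℂ))
    · simp only [↓reduceIte, Letter.eval_gen, smul_neg]
      exact continuous_exp_MatN.comp (((continuous_gen Λ ⟨b, hb⟩).const_smul (c : ℂ)).neg)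
  · simp only [dif_neg hb]
    cases inv <;> simp only [Bool.false_eq_true, ↓reduceIte, Letter.eval_frozen] <;> exact continuous_const

omit [NeZero N] in
/-- **THE SECTIONED PLAQUETTE WORD IS CONTINUOUS IN THE CHART POINT**. [folklore] -/
theorem continuous_wordEval_plaqWord (V : GaugeField P j (SUN N)) (p : Plaq P j) (c : ℝ) :
    Continuous fun x : BlockChartSU N Λ => wordEval c (plaqWord Λ V x p) := by
  have hl := fun (b : PBond P j) (inv : Bool) => continuous_letter_eval Λ V b inv c
  unfold plaqWord
  simp only [ShellMeasureWilsonTrace.wordEval_cons, ShellMeasureWilsonTrace.wordEval_nil]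
  exact (hl ⟨p.src, p.μ⟩ false).mul ((hl ⟨p.src.shift p.μ, p.ν⟩ false).mul
    ((hl ⟨p.src.shift p.ν, p.μ⟩ true).mul ((hl ⟨p.src, p.ν⟩ true).mul continuous_const)))

end Continuity
/-! ## §3 The gauge-invariant realized objects for `SU(N)` (`SU(N)` twins of S1 §3) -/

section Objects

variable (lo hi : Fin P.d → ℤ)

/-- THE INTERIOR PLAQUETTE CO-TEST of the box: all box plaquettes `σ`-small. [folklore] -/
def boxTest (σ : ℝ) : Set (GaugeField P j (SUN N)) := {U | PlaqSmallOn (boxPlaqs lo hi) σ U}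

/-- THE GAUGE-INVARIANT REALIZED DENSITY: co-test indicator times the Wilson weight over `P_w`. [folklore] -/
def giF (σ β : ℝ) (Pw : Finset (Plaq P j)) (U : GaugeField P j (SUN N)) : ℝ≥0∞ :=
  (boxTest (N := N) lo hi σ).indicator 1 U *
    ENNReal.ofReal (Real.exp (-(β * ∑ p ∈ Pw, (1 - reTr (GaugeField.plaqHol U p)))))

variable {lo hi}

/-- membership in the co-test, unfolded. [folklore] -/ theorem mem_boxTest_iff {σ : ℝ} {U : GaugeField P j (SUN N)} :
    U ∈ boxTest lo hi σ ↔ ∀ p ∈ boxPlaqs lo hi, dist1 (GaugeField.plaqHol U p) < σ := Iff.rfl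

variable (lo hi)

/-- the co-test event is measurable. [folklore] -/
theorem measurableSet_boxTest (σ : ℝ) : MeasurableSet (boxTest lo hi σ : Set (GaugeField P j (SUN N))) := by
  have h : (boxTest lo hi σ : Set (GaugeField P j (SUN N))) =
      ⋂ p ∈ boxPlaqs lo hi, {U | dist1 (GaugeField.plaqHol U p) < σ} := by
    ext U
    simp only [mem_boxTest_iff, mem_iInter, mem_setOf_eq]
  rw [h]
  exact MeasurableSet.biInter (Set.to_countable _) fun p _ =>
    measurableSet_lt (RegularGaugeGroup.measurable_dist1.comp (Missing.measurable_plaqHol p)) measurable_const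

/-- `giF` is measurable. [folklore] -/
theorem measurable_giF (σ β : ℝ) (Pw : Finset (Plaq P j)) : Measurable (giF (N := N) lo hi σ β Pw) := by
  unfold giF
  refine (measurable_one.indicator (measurableSet_boxTest lo hi σ)).mul ?_
  exact ENNReal.measurable_ofReal.comp (Real.measurable_exp.comp ((measurable_const.mul (measurable_wilsonSum Pw))).neg)

/-- `giF ≤ 1` (`β ≥ 0`). [folklore] -/
theorem giF_le_one {σ β : ℝ} (hβ : 0 ≤ β) (Pw : Finset (Plaq P j)) (U : GaugeField P j (SUN N)) :
    giF lo hi σ β Pw U ≤ 1 := by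
  unfold giF
  have h1 : (boxTest lo hi σ).indicator (1 : GaugeField P j (SUN N) → ℝ≥0∞) U ≤ 1 :=
    indicator_apply_le' (fun _ => le_rfl) (fun _ => zero_le_one)
  have h2 : ENNReal.ofReal (Real.exp (-(β * ∑ p ∈ Pw, (1 - reTr (GaugeField.plaqHol U p))))) ≤ 1 := by
    rw [ENNReal.ofReal_le_one, Real.exp_le_one_iff, neg_nonpos]
    exact mul_nonneg hβ (wilsonSum_nonneg Pw U)
  calc _ ≤ (1 : ℝ≥0∞) * 1 := mul_le_mul' h1 h2
    _ = 1 := one_mul _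

/-- the co-test is gauge invariant (plaquette variables are conjugated, `dist1` is a class function). [folklore] -/
theorem boxTest_gaugeAct_iff (σ : ℝ) (g : GaugeTransf P j (SUN N)) (U : GaugeField P j (SUN N)) :
    GaugeField.gaugeAct g U ∈ boxTest lo hi σ ↔ U ∈ boxTest lo hi σ := by
  simp only [mem_boxTest_iff, T4ReTrLipUnitary.plaqHol_gaugeAct, GaugeGroup.dist1_conj]

/-- the Wilson energy over `P_w` is gauge invariant (`reTr` is a class function). [folklore] -/
theorem wilsonSum_gaugeAct (Pw : Finset (Plaq P j)) (g : GaugeTransf P j (SUN N)) (U : GaugeField P j (SUN N)) :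
    ∑ p ∈ Pw, (1 - reTr (GaugeField.plaqHol (GaugeField.gaugeAct g U) p)) =
      ∑ p ∈ Pw, (1 - reTr (GaugeField.plaqHol U p)) :=
  Finset.sum_congr rfl fun p _ => by rw [T4ReTrLipUnitary.plaqHol_gaugeAct, GaugeGroup.reTr_conj]

/-- **THE DENSITY IS GAUGE INVARIANT**. [folklore] -/
theorem gaugeInvariant_giF (σ β : ℝ) (Pw : Finset (Plaq P j)) : GaugeInvariant (giF (N := N) lo hi σ β Pw) := by
  intro g U
  by_cases hU : U ∈ boxTest lo hi σ
  · have hgU : GaugeField.gaugeAct g U ∈ boxTest lo hi σ := (boxTest_gaugeAct_iff lo hi σ g U).2 hU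
    unfold giF
    rw [indicator_of_mem hU, indicator_of_mem hgU, wilsonSum_gaugeAct]
    simp only [Pi.one_apply]
  · have hgU : GaugeField.gaugeAct g U ∉ boxTest lo hi σ := mt (boxTest_gaugeAct_iff lo hi σ g U).1 hU
    unfold giF
    rw [indicator_of_notMem hU, indicator_of_notMem hgU, zero_mul, zero_mul]

/-- **THE CLASSIFIER IS GAUGE INVARIANT**. [folklore] -/
theorem gaugeInvariant_wilsonU {Pu : Finset (Plaq P j)} (hPu : Pu.Nonempty) :
    GaugeInvariant (wilsonU hPu (P := P) (j := j) (N := N)) := by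
  intro g U
  unfold wilsonU
  exact Finset.sup'_congr hPu rfl fun p _ => by rw [T4ReTrLipUnitary.plaqHol_gaugeAct, GaugeGroup.dist1_conj]

end Objects
/-! ## §4 (M1)₀ realized for `SU(N)`, gauge-invariant form, the window DERIVED — from END-II for `SU(N)` -/

section Main

variable [DecidableEq (PBond P j)]

/-- **(M1)₀ REALIZED FOR `G = SU(N)`, GAUGE-INVARIANT DENSITY, NO BOND WINDOW, FROM END-II** — see the module
docstring.  The only inputs that are not identities are (SM) in END-II's currency `36(e^{4S·Rad} − 1)/(Rad − 1)² ≤ δθ`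
for a free radius `Rad > 1`, (SM)_σ `4(4S)²e^{8S} ≤ δσ`, and the reach conditions `N·((d−1)·m·σ) < 4`,
`√N·(π/2)·((d−1)·m·σ) ≤ S` of `ShellMeasureAxialReachSUN`.  (M1)₀ realized ≠ NE7c. [folklore] -/
theorem slotAntiConcentration_wilson_suN_gaugeInvariant
    {lo hi : Fin P.d → ℤ} {m : ℕ} (hN : ∀ κ, hi κ - lo κ < P.sitesPerDir j) (hm : ∀ κ, hi κ ≤ lo κ + m)
    (Λ : Finset (PBond P j)) (hΛbox : ∀ b ∈ Λ, b ∈ boxBonds lo hi)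
    (hΛcomb : Disjoint Λ (combBonds lo hi))
    (hcov : ∀ b ∈ boxBonds lo hi, b ∉ Λ → b ∈ (combBonds lo hi : Finset (PBond P j)))
    {S σ : ℝ} (hS : 0 ≤ S) (hS4 : S ≤ 1 / 4) (hσ : 0 < σ)
    (hN4 : (N : ℝ) * (((P.d - 1 : ℕ) : ℝ) * m * σ) < 4)
    (hrad : Real.sqrt N * (Real.pi / 2 * (((P.d - 1 : ℕ) : ℝ) * m * σ)) ≤ S)
    {Pu : Finset (Plaq P j)} (hPu : Pu.Nonempty) (hPubox : ∀ p ∈ Pu, p ∈ boxPlaqs lo hi)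
    (Pw : Finset (Plaq P j)) {β θ δ ρ Rad : ℝ} (hβ : 0 ≤ β) (hθ : 0 < θ) (hδ0 : 0 ≤ δ) (hδ1 : δ < 1) (hρ0 : 0 ≤ ρ)
    (hρ : ρ ≤ (1 - δ) / 2) (hRad : 1 < Rad)
    (hSM : 36 * (Real.exp (4 * S * Rad) - 1) / (Rad - 1) ^ 2 ≤ δ * θ)
    (hSMσ : 4 * (4 * S) ^ 2 * Real.exp (2 * (4 * S)) ≤ δ * σ) :
    SlotAntiConcentration ((fieldMeasure P j (SUN N)).withDensity (giF lo hi σ β Pw)) (wilsonU hPu) θ ρ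
      (2 * (((Λ.card * dimSU N : ℕ) : ℝ) + β * ∑ _p ∈ Pw, (4 * S) * (8 + 4 * (4 * S))) / (1 - δ)) := by
  classical
  have hSπ : S ≤ Real.pi := by linarith [Real.pi_gt_three]
  have h4S1 : 4 * S ≤ 1 := by linarith
  have hT := noClosedLoop_combBonds (P := P) (j := j) hN
  have hWcomb : ∀ (V : GaugeField P j (SUN N)), ∀ b ∈ boxBonds lo hi, b ∉ Λ →
      fixTo (combBonds lo hi) 1 V b = 1 :=
    fun V b hb hbΛ => ShellMeasureAxialReach.fixTo_comb_eq_one lo hi V b (hcov b hb hbΛ)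
  have hgen : ∀ (V : GaugeField P j (SUN N)) (x : BlockChartSU N Λ) (p : Plaq P j), p ∈ boxPlaqs lo hi →
      ∃ l : List (MatN N), normSum l = sGen (plaqWord Λ (fixTo (combBonds lo hi) 1 V) x p) ∧
        ∀ c : ℝ, wordEval c (plaqWord Λ (fixTo (combBonds lo hi) 1 V) x p) = wordExp (scale c l) :=
    fun V x p hp => exists_gens_of_frozen_eq_one _ (frozen_eq_one_of_mem_plaqWord Λ (hWcomb V) x hp)
  choose! L hLnorm hLeval using hgen
  have hsec : ∀ (V : GaugeField P j (SUN N)) (y : ↥Λ → SUN N),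
      fixTo (combBonds lo hi) 1 (updateFinset V Λ y) = updateFinset (fixTo (combBonds lo hi) 1 V) Λ y :=
    fun V y => fixTo_updateFinset_of_disjoint hΛcomb 1 V y
  have hD1 : ∀ (V : GaugeField P j (SUN N)) (x : BlockChartSU N Λ) (p : Plaq P j), p ∈ boxPlaqs lo hi → ∀ c : ℝ,
      dist1 (GaugeField.plaqHol (fixTo (combBonds lo hi) 1
        (updateFinset V Λ (expFibreChartSU Λ 1 (c • x)))) p) = ‖wordExp (scale c (L V x p)) - 1‖ := by
    intro V x p hp c
    rw [hsec, ← (wilson_dictionary_specialUnitaryGroup _).2, coe_plaqHol_eq_wordEval, wordEval_plaqWord_smul,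
      hLeval V x p hp c]
  have hD1one : ∀ (V : GaugeField P j (SUN N)) (x : BlockChartSU N Λ) (p : Plaq P j), p ∈ boxPlaqs lo hi →
      dist1 (GaugeField.plaqHol (fixTo (combBonds lo hi) 1
        (updateFinset V Λ (expFibreChartSU Λ 1 x))) p) = ‖wordExp (L V x p) - 1‖ := by
    intro V x p hp
    have h := hD1 V x p hp 1
    rwa [one_smul, scale_one] at h
  have hLsize : ∀ (V : GaugeField P j (SUN N)) (x : BlockChartSU N Λ), x ∈ closedBall (0 : BlockChartSU N Λ) S →
      ∀ p ∈ boxPlaqs lo hi, normSum (L V x p) ≤ 4 * S := by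
    intro V x hx p hp
    rw [hLnorm V x p hp]
    exact (plaqWord_data Λ hS (fixTo (combBonds lo hi) 1 V) hx p).2.1
  have hmono : ∀ (V : GaugeField P j (SUN N)) (x : BlockChartSU N Λ), x ∈ closedBall (0 : BlockChartSU N Λ) S →
      ∀ c : ℝ, 0 < c → c ≤ 1 →
      fixTo (combBonds lo hi) 1 (updateFinset V Λ (expFibreChartSU Λ 1 x)) ∈ boxTest lo hi σ →
      fixTo (combBonds lo hi) 1 (updateFinset V Λ (expFibreChartSU Λ 1 (c • x))) ∈ boxTest lo hi σ := by
    intro V x hx c hc0 hc1 hmem p hp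
    rw [hD1 V x p hp c]
    have h1 : ‖wordExp (L V x p) - 1‖ < σ := by rw [← hD1one V x p hp]; exact hmem p hp
    have hs := hLsize V x hx p hp
    have hδc : δ * c ≤ 1 := by nlinarith
    have hcρ : c * (1 + δ * (1 - c)) ≤ 1 - 0 := by nlinarith [mul_nonneg (mul_nonneg hδ0 hc0.le) (sub_nonneg.2 hc1)]
    have h := coreMap_word (L V x p) hc0 hc1 (hs.trans h4S1) hσ
      ((interpConst_mono (normSum_nonneg _) hs).trans hSMσ) hcρ h1
    simpa using h
  have h := slotAC_realized_suN_of_levelData_ball (A := MatN N) hT 1 Λ hS hSπ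
    (fun _ => (1 : GaugeField P j (SUN N)))
    (R := fun V y => giF lo hi σ β Pw (fixTo (combBonds lo hi) 1 (updateFinset V Λ y)))
    (fun V => (measurable_giF lo hi σ β Pw).comp ((measurable_fixTo _ 1).comp measurable_updateFinset))
    (measurable_giF lo hi σ β Pw) (gaugeInvariant_giF lo hi σ β Pw) ?hFw
    (fun V => withDensity_univ_ne_top_of_le_one (blockLaw Λ) fun y => giF_le_one lo hi hβ Pw _)
    (measurable_wilsonU hPu) (gaugeInvariant_wilsonU hPu)
    (matrixTrace (n := Fin N)) matrixTrace_N_pos hPu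
    (fun V p x => wordEval 1 (plaqWord Λ (fixTo (combBonds lo hi) 1 V) x p))
    (fun V p _ => continuous_wordEval_plaqWord Λ _ p 1) Pw
    (fun V p x => wordEval 1 (plaqWord Λ (fixTo (combBonds lo hi) 1 V) x p)) (fun _ _ => (0 : ℝ))
    (fun _ => closedBall (0 : BlockChartSU N Λ) S)
    (fun V x => (closedBall (0 : BlockChartSU N Λ) S).indicator 1 x *
      (boxTest lo hi σ).indicator 1 (fixTo (combBonds lo hi) 1 (updateFinset V Λ (expFibreChartSU Λ 1 x))))
    (θ := θ) (δ := δ) (ρ := ρ) (β := β) (Rad := Rad) (H := Real.exp (4 * S * Rad) - 1) (B𝓔 := 0)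
    (sw := fun _ => 4 * S) (lw := fun _ => 4 * S) (dw := fun _ => 8)
    ?hRdict ?hudict ?hJW ?hJ hRad ?hAN ?hGW (fun _ _ => h4S1) (fun _ _ => by positivity) (fun _ _ => by positivity)
    (fun _ _ => by norm_num) ?hE le_rfl hθ hδ0 hδ1 hρ0 hρ hβ ?hSM
  · simpa only [add_zero] using h
  case hFw =>
    intro V y
    by_cases hmem : fixTo (combBonds lo hi) 1 (updateFinset V Λ y) ∈ boxTest lo hi σ
    · have hwin := windowSU_fixTo_comb_eq_one (updateFinset V Λ y) (S₀ := boxPlaqs lo hi) subset_rfl hmem hσ.le hm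
        hN4 hrad Λ hΛbox
      have hcongr : (fun b : ↥Λ => fixTo (combBonds lo hi) 1 (updateFinset V Λ y) b) = y := by
        funext b
        have hbT : (b : PBond P j) ∉ combBonds lo hi := Finset.disjoint_left.1 hΛcomb b.2
        simp [fixTo, updateFinset, b.2, hbT]
      rw [hcongr] at hwin
      show _ = windowSU Λ (1 : GaugeField P j (SUN N)) S y * _
      rw [hwin, one_mul]
    · have h0 : giF lo hi σ β Pw (fixTo (combBonds lo hi) 1 (updateFinset V Λ y)) = 0 := by
        unfold giF; rw [indicator_of_notMem hmem, zero_mul]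
      show giF lo hi σ β Pw (fixTo (combBonds lo hi) 1 (updateFinset V Λ y)) = _
      rw [h0, mul_zero]
  case hRdict =>
    intro V x hx
    simp only [indicator_of_mem hx, Pi.one_apply, one_mul]
    unfold giF weight ShellMeasureLevelAssembly.action
    have hsum := wilsonSum_chart_smul Λ Pw (fixTo (combBonds lo hi) 1 V) x 1
    rw [one_smul] at hsum
    rw [add_zero, hsec, hsum, ← hsec]
  case hudict =>
    intro V x _
    unfold wilsonU classifier
    refine Finset.sup'_congr hPu rfl fun p _ => ?_
    rw [hsec, ← (wilson_dictionary_specialUnitaryGroup _).2, coe_plaqHol_eq_wordEval]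
  case hJW =>
    intro V x hJx
    by_contra hx
    exact hJx (by rw [indicator_of_notMem hx, zero_mul])
  case hJ =>
    intro V x a ha
    have hc0 : 0 < Real.exp (-a) := Real.exp_pos _
    have hc1 : Real.exp (-a) ≤ 1 := by rw [Real.exp_le_one_iff]; linarith
    by_cases hx : x ∈ closedBall (0 : BlockChartSU N Λ) S
    · by_cases hmem : fixTo (combBonds lo hi) 1 (updateFinset V Λ (expFibreChartSU Λ 1 x)) ∈ boxTest lo hi σ
      · have hx' : Real.exp (-a) • x ∈ closedBall (0 : BlockChartSU N Λ) S := smul_mem_closedBall_zero hx hc0.le hc1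
        have hmem' := hmono V x hx (Real.exp (-a)) hc0 hc1 hmem
        rw [indicator_of_mem hx, indicator_of_mem hx', indicator_of_mem hmem, indicator_of_mem hmem']
        simp only [Pi.one_apply, mul_one, le_refl]
      · rw [indicator_of_notMem hmem, mul_zero]
        exact bot_le
    · rw [indicator_of_notMem hx, zero_mul]
      exact bot_le
  case hAN =>
    intro V x hx p hp
    obtain ⟨f, hf, hb, h0, hc⟩ := classifierWitness_linear (L V x p) Rad
    refine ⟨f, hf, fun w hw => (hb w hw).trans ?_, h0, fun c' h1 h2 => ?_⟩
    · have hs := hLsize V x hx p (hPubox p hp)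
      have hR0 : 0 ≤ Rad := by linarith
      apply sub_le_sub_right
      apply Real.exp_le_exp.2
      nlinarith
    · rw [hc c' h1 h2]
      show wordExp (scale c' (L V x p)) - 1 =
        wordEval 1 (plaqWord Λ (fixTo (combBonds lo hi) 1 V) (c' • x) p) - 1
      rw [wordEval_plaqWord_smul, hLeval V x p (hPubox p hp) c']
  case hGW =>
    intro V x hx p _
    obtain ⟨hgood, hs, hd⟩ := plaqWord_data Λ hS (fixTo (combBonds lo hi) 1 V) hx p
    obtain ⟨gw, hg, hss, hls, hmd, hev⟩ := exists_graded_of_word (matrixTrace (n := Fin N)) _ hgood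
    refine ⟨gw, hg, hss ▸ hs, hls ▸ hs, hmd ▸ hd, fun c' _ _ => ?_⟩
    show mwordEval c' (gw.map Prod.fst) = wordEval 1 (plaqWord Λ (fixTo (combBonds lo hi) 1 V) (c' • x) p)
    rw [hev c', wordEval_plaqWord_smul]
  case hE =>
    intro V x _ c' _ _
    simp
  case hSM =>
    simpa only [one_pow, mul_one] using hSM

end Main

end Summit.QuantumFields.BalabanUV.T4Continuum.ShellMeasureWilsonGaugeInvariantSUN
end
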